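import Literature.MathematicalPhysics.QuantumFieldTheory.ConformalBootstrap3D.PointKernelK34v2Data
import Literature.MathematicalPhysics.QuantumFieldTheory.ConformalBootstrap3D.PointKernelParts

/-!
# K34v2 certificate, kernel part file P14: one-cell head segments 111, 112, 139 in level ranges

The head cells whose kernel evaluation exceeds one `decide` are one-cell segments of `hsegsK34v2`; each is
checked by `PCert.hPartSideOK` (side conditions) and `PCert.hPartOK` per level range `[n_lo, n_lo + count)`
against an integer claim, the claims summing to `≥ 0` (`PointKernel.partsOK`); soundness is
`PCert.hParts_sound` (`PointKernelParts`).  The part files `P1, P2, …` are mutually independent (each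
imports only the data file); the ranges of one cell may span several of them, and the per-cell
conclusions `hparts_i` / `hcell_i` of those cells are assembled in `PointKernelK34v2.lean`.
Estimated kernel time 247 s.
-/

set_option maxRecDepth 100000
set_option maxHeartbeats 0

namespace Literature.MathematicalPhysics.QuantumFieldTheory.ConformalBootstrap3D.PointKernelK34v2

open Literature.MathematicalPhysics.QuantumFieldTheory.ConformalBootstrap3D.PointKernel

/-- levels `[0, 31)` of segment 111: partial lower sum `≥` claim. [folklore] -/
theorem part_111_0 : certK34v2.hPartOK (PCert.segAt hsegsK34v2 111) JHK34v2 0 31 (0) = true := by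
  decide +kernel

/-- one-cell segment 112 (row 4, cell `[323/64, 81/16]`, chord, `n_F = 30`,
1 level ranges): side conditions. [folklore] -/
theorem pside_112 : certK34v2.hPartSideOK (PCert.segAt hsegsK34v2 112) JHK34v2 = true := by
  decide +kernel

/-- its level ranges `(n_lo, count, claim)`. [folklore] -/
def parts_112 : List (ℕ × ℕ × ℤ) := [(0, 31, 0)]

/-- the ranges tile `[0, n_F]` and the claims sum to `≥ 0`. [folklore] -/
theorem pcov_112 : PointKernel.partsOK 30 parts_112 = true := by
  decide +kernel

/-- levels `[0, 31)` of segment 112: partial lower sum `≥` claim. [folklore] -/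
theorem part_112_0 : certK34v2.hPartOK (PCert.segAt hsegsK34v2 112) JHK34v2 0 31 (0) = true := by
  decide +kernel

/-- one-cell segment 139 (row 6, cell `[7, 28673/4096]`, chord, `n_F = 72`,
10 level ranges): side conditions. [folklore] -/
theorem pside_139 : certK34v2.hPartSideOK (PCert.segAt hsegsK34v2 139) JHK34v2 = true := by
  decide +kernel

/-- its level ranges `(n_lo, count, claim)`. [folklore] -/
def parts_139 : List (ℕ × ℕ × ℤ) := [(0, 25, -43328306207051823130616655284683207975), (25, 11, 27501405555031265253270240885751593123), (36, 8, 9214491086209422073025402839844289019), (44, 6, 3334274856583800406030494444907194704), (50, 5, 1522430523169536838382944394035501359), (55, 5, 874708325607452537520059527030255181), (60, 4, 419322431147157045196869440658551928), (64, 4, 266169398211169834247329785443169976), (68, 3, 131818278826076264115671867414797804), (71, 2, 63685752265942878827642099597854885)]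

/-- the ranges tile `[0, n_F]` and the claims sum to `≥ 0`. [folklore] -/
theorem pcov_139 : PointKernel.partsOK 72 parts_139 = true := by
  decide +kernel

/-- levels `[0, 25)` of segment 139: partial lower sum `≥` claim. [folklore] -/
theorem part_139_0 : certK34v2.hPartOK (PCert.segAt hsegsK34v2 139) JHK34v2 0 25 (-43328306207051823130616655284683207975) = true := by
  decide +kernel

/-- levels `[25, 36)` of segment 139: partial lower sum `≥` claim. [folklore] -/
theorem part_139_1 : certK34v2.hPartOK (PCert.segAt hsegsK34v2 139) JHK34v2 25 11 (27501405555031265253270240885751593123) = true := by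
  decide +kernel

end Literature.MathematicalPhysics.QuantumFieldTheory.ConformalBootstrap3D.PointKernelK34v2
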